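import Summits.MatrixMultiplication.MatrixMultiplication.Theorems.LevelGradedCohnUmansLevelOneGL2DesignsTangencyPlaneSRSBound

/-!
# Extremal strong representative systems ARE unitals (Thas 1974 / Illés–Szőnyi–Wettl 1991, the
equality case), in an abstract projective plane — stub `stub_tangencySets` (crux `LevelOneGL2Designs`,
stmt-MatrixMultiplication-14080), wall-breaker axis 10/12 "Hermitian unital constructions",
generation 1 (seat 3), part 1

The axis is named after the one configuration that meets the stub's exponent `3/2` with constant
`1`: the Hermitian unital.  The tree has the bound (`PlaneSRS.srs_card_sub_one_sq_le`: a strong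
representative system `S` — flags `(pᵢ, ℓᵢ)` with `pᵢ ∈ ℓⱼ ↔ i = j` — of a projective plane of order
`n` has `(|S| − 1)² ≤ n³`) and the square-order construction (`FlagLine.TangencyHermitian.hermitian_srs`),
but not the classical converse that ties the two together and that the docstrings of the axis quote:
**equality holds only for unitals**.  This file proves it for Mathlib's abstract
`Configuration.ProjectivePlane` (every finite projective plane, Desarguesian or not):

* `srs_moments` — the bookkeeping behind ISW as reusable API: the `|S|` designated lines are
  tangents (degree `1`); over the OTHER `n² + n + 1 − |S|` lines the degrees `k_ℓ = #{f ∈ S : f.1 ∈ ℓ}`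
  satisfy `Σ k_ℓ = |S|·n` and `Σ k_ℓ² = |S|(|S| − 1) + |S|·n`;
* `srs_variance_identity` — hence, exactly, `(n²+n+1−|S|)·Σ k_ℓ² − (Σ k_ℓ)² = |S|·(n³ − (|S|−1)²)`:
  the ISW slack IS the variance of the secant degrees (the quantitative "near-unital" statement);
* `srs_extremal_structure` (**equality ⇒ unital**) — if `(|S| − 1)² = n³` then `n = r²` is a perfect
  square, `|S| = r³ + 1`, and every line not among the designated tangents meets the point set `V` of
  `S` in exactly `r + 1` points; so `V` is a unital (`r³ + 1` points of a plane of order `r²` met by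
  every line in `1` or `r + 1` points), every line meets `V` (`srs_extremal_blocking`), and the tangent
  at each point of `V` is unique — the system is determined by its point set
  (`srs_extremal_tangent_unique`);
* `srs_card_sub_one_sq_lt_of_not_isSquare`, `…_of_prime` — so in a plane of non-square (e.g. prime)
  order the bound is strict.

The converse (a unital with its tangents IS an extremal system; each of its points is on exactly one
tangent) is part 2, `…TangencyPlaneUnitalConverse`; integrality refinements of the same moments are
part 3.  Reading for the stub: `stub_tangencySets` asks for systems of size `c·p^{3/2}` in `AG(2,p)`,
`p` prime, for SOME `c > 0`; the theorem says the constant `c = 1` is rigid — it forces the unital,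
hence square order — and says nothing below `c = 1`; with Baer's theorem
(`BaerPolarity.card_absolute_eq_of_prime`: polar systems have `p + 1` flags) it is the complete
classical content of the "Hermitian unital" heuristic, leaving the prime-order window
`[p^{3/2−ε}, p^{3/2})` (Pohoata 2026 / ISW) where the literature has it.
Sources: J. A. Thas, Geom. Dedicata 3 (1974) (semiovals); Illés–Szőnyi–Wettl, Mitt. Math. Sem.
Giessen 201 (1991) (Zbl 0741.51013); Kiss, *A survey on semiovals*, Contrib. Discrete Math. 3 (2008),
Thm 1.3.  Elementary double counting; Mathlib + `…TangencyPlaneSRSBound`; no definitions.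
-/

-- `Summit.MatrixMultiplication.MatrixMultiplication.…` is the tree's mandated summit/problem namespace (D-0017).
set_option linter.dupNamespace false

namespace Summit.MatrixMultiplication.MatrixMultiplication.Theorems.LevelOneGL2Designs.PlaneUnital

open Finset Configuration
open Summit.MatrixMultiplication.MatrixMultiplication.Theorems.LevelOneGL2Designs.PlaneSRS
  (card_filter_mem_line_pair srs_card_sub_one_sq_le)

variable {P L : Type*} [Membership P L] [Configuration.ProjectivePlane P L] [Fintype P] [Fintype L]

/-! ## Moments of the line degrees -/

open scoped Classical in
/-- **Line moments of a strong representative system.**  Let `S` be a strong representative system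
of a projective plane of order `n` (`f.1 ∈ g.2 ↔ f = g` on `S`), `N = |S|`, and for a line `ℓ` let
`k_ℓ = #{f ∈ S : f.1 ∈ ℓ}`.  Then (i) every designated line `f.2` has `k = 1`; over the other lines
(ii) `Σ k_ℓ = N·n` and (iii) `Σ k_ℓ² = N(N−1) + N·n`; and (iv) there are `n² + n + 1 − N` other lines.
(Each point lies on `n + 1` lines, two distinct points on exactly one.) [bookkeeping; Illés–Szőnyi–Wettl 1991] -/
theorem srs_moments (S : Finset (P × L)) (hS : ∀ f ∈ S, ∀ g ∈ S, (f.1 ∈ g.2 ↔ f = g)) :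
    (∀ ℓ ∈ S.image Prod.snd, (S.filter fun f => f.1 ∈ ℓ).card = 1) ∧
    (∑ ℓ ∈ univ \ S.image Prod.snd, (S.filter fun f => f.1 ∈ ℓ).card =
        S.card * ProjectivePlane.order P L) ∧
    (∑ ℓ ∈ univ \ S.image Prod.snd, (S.filter fun f => f.1 ∈ ℓ).card ^ 2 =
        S.card * (S.card - 1) + S.card * ProjectivePlane.order P L) ∧
    ((univ \ S.image Prod.snd).card + S.card =
        ProjectivePlane.order P L ^ 2 + ProjectivePlane.order P L + 1) := by
  set n : ℕ := ProjectivePlane.order P L with hn_def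
  set N : ℕ := S.card with hN_def
  have hLcard : Fintype.card L = n ^ 2 + n + 1 := ProjectivePlane.card_lines P L
  -- distinct flags have distinct points and distinct lines
  have hpt : ∀ f ∈ S, ∀ g ∈ S, f.1 = g.1 → f = g := by
    intro f hf g hg h
    exact (hS f hf g hg).mp (h ▸ (hS g hg g hg).mpr rfl)
  have hln : ∀ f ∈ S, ∀ g ∈ S, f.2 = g.2 → f = g := by
    intro f hf g hg h
    exact ((hS g hg f hf).mp (h ▸ (hS g hg g hg).mpr rfl)).symm
  set k : L → ℕ := fun ℓ => (S.filter fun f => f.1 ∈ ℓ).card with hk_def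
  have hk : ∀ ℓ, k ℓ = ∑ f ∈ S, if f.1 ∈ ℓ then 1 else 0 := fun ℓ => Finset.card_filter _ _
  -- first moment over all lines
  have h1 : ∑ ℓ, k ℓ = N * (n + 1) := by
    simp_rw [hk]
    rw [Finset.sum_comm]
    have h : ∀ f ∈ S, (∑ ℓ : L, if f.1 ∈ ℓ then 1 else 0) = n + 1 := by
      intro f _
      rw [← Finset.card_filter, ← ProjectivePlane.lineCount_eq L f.1, Configuration.lineCount,
        Nat.card_eq_fintype_card, Fintype.card_subtype]
    rw [Finset.sum_congr rfl h, Finset.sum_const, smul_eq_mul]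
  -- second moment over all lines
  have h2 : ∑ ℓ, k ℓ ^ 2 = N * (N + n) := by
    have hsq : ∀ ℓ, k ℓ ^ 2 = ∑ f ∈ S, ∑ g ∈ S, if f.1 ∈ ℓ ∧ g.1 ∈ ℓ then 1 else 0 := by
      intro ℓ
      rw [sq, hk, Finset.sum_mul_sum]
      refine Finset.sum_congr rfl fun f _ => Finset.sum_congr rfl fun g _ => ?_
      rw [ite_zero_mul_ite_zero, mul_one]
    simp_rw [hsq]
    rw [Finset.sum_comm]
    have h : ∀ f ∈ S, (∑ ℓ : L, ∑ g ∈ S, if f.1 ∈ ℓ ∧ g.1 ∈ ℓ then 1 else 0) = N + n := by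
      intro f hf
      rw [Finset.sum_comm]
      have hg : ∀ g ∈ S, (∑ ℓ : L, if f.1 ∈ ℓ ∧ g.1 ∈ ℓ then 1 else 0) =
          1 + (if f = g then n else 0) := by
        intro g hg
        rw [← Finset.card_filter, card_filter_mem_line_pair]
        by_cases hfg : f = g
        · subst hfg
          rw [if_pos rfl, if_pos rfl]
          ring
        · have : f.1 ≠ g.1 := fun h => hfg (hpt f hf g hg h)
          rw [if_neg this, if_neg hfg]
      rw [Finset.sum_congr rfl hg, Finset.sum_add_distrib, Finset.sum_const, smul_eq_mul, mul_one,
        Finset.sum_ite_eq]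
      rw [if_pos hf]
    rw [Finset.sum_congr rfl h, Finset.sum_const, smul_eq_mul]
  -- (i) the designated lines are tangents
  set Λ : Finset L := S.image Prod.snd with hΛ_def
  have hΛcard : Λ.card = N := by
    rw [hΛ_def, Finset.card_image_of_injOn]
    intro f hf g hg h
    exact hln f hf g hg h
  have hkΛ : ∀ ℓ ∈ Λ, k ℓ = 1 := by
    intro ℓ hℓ
    obtain ⟨f, hf, rfl⟩ := Finset.mem_image.mp hℓ
    change (S.filter fun g => g.1 ∈ f.2).card = 1
    rw [Finset.card_eq_one]
    refine ⟨f, Finset.eq_singleton_iff_unique_mem.mpr ⟨?_, fun g hg => ?_⟩⟩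
    · exact Finset.mem_filter.mpr ⟨hf, (hS f hf f hf).mpr rfl⟩
    · obtain ⟨hg, hgf⟩ := Finset.mem_filter.mp hg
      exact (hS g hg f hf).mp hgf
  -- (ii)–(iv) moments over the other lines
  set L' : Finset L := univ \ Λ with hL'_def
  have hsplit : ∀ g : L → ℕ, ∑ ℓ ∈ L', g ℓ + ∑ ℓ ∈ Λ, g ℓ = ∑ ℓ, g ℓ := fun g =>
    Finset.sum_sdiff (Finset.subset_univ Λ)
  have hΛ1 : ∑ ℓ ∈ Λ, k ℓ = N := by
    rw [Finset.sum_congr rfl hkΛ, Finset.sum_const, smul_eq_mul, mul_one, hΛcard]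
  have hΛ2 : ∑ ℓ ∈ Λ, k ℓ ^ 2 = N := by
    rw [Finset.sum_congr rfl fun ℓ hℓ => by rw [hkΛ ℓ hℓ], Finset.sum_const, smul_eq_mul, one_pow,
      mul_one, hΛcard]
  have ha : ∑ ℓ ∈ L', k ℓ + N = N * (n + 1) := by rw [← h1, ← hsplit k, hΛ1]
  have hb : ∑ ℓ ∈ L', k ℓ ^ 2 + N = N * (N + n) := by
    rw [← h2, ← hsplit (fun ℓ => k ℓ ^ 2), hΛ2]
  have hc : L'.card + N = n ^ 2 + n + 1 := by
    rw [hL'_def, Finset.card_sdiff_of_subset (Finset.subset_univ Λ), Finset.card_univ, hLcard, hΛcard,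
      Nat.sub_add_cancel]
    rw [← hLcard, ← hΛcard]
    exact Finset.card_le_univ Λ
  have hNN : N * (N - 1) + N = N * N := by
    rcases Nat.eq_zero_or_pos N with h0 | hpos
    · rw [h0]
    · calc N * (N - 1) + N = N * (N - 1) + N * 1 := by rw [mul_one]
        _ = N * (N - 1 + 1) := by rw [mul_add]
        _ = N * N := by rw [Nat.sub_add_cancel hpos]
  refine ⟨hkΛ, ?_, ?_, hc⟩
  · have : ∑ ℓ ∈ L', k ℓ + N = N * n + N := by rw [ha]; ring
    exact Nat.add_right_cancel this
  · have : ∑ ℓ ∈ L', k ℓ ^ 2 + N = (N * (N - 1) + N * n) + N := by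
      rw [hb]
      calc N * (N + n) = N * N + N * n := by ring
        _ = (N * (N - 1) + N) + N * n := by rw [hNN]
        _ = (N * (N - 1) + N * n) + N := by ring
    exact Nat.add_right_cancel this

open scoped Classical in
/-- **The ISW slack is a variance.**  With the notation of `srs_moments` and `M = n² + n + 1 − N`
the number of non-designated lines, `M·Σ k_ℓ² − (Σ k_ℓ)² = N·(n³ − (N − 1)²)` (an identity of
integers).  Its left side is `Σ_ℓ Σ_ℓ' (k_ℓ − k_ℓ')²/2 ≥ 0` — this is the Illés–Szőnyi–Wettl bound —
and it vanishes iff all secant degrees agree. [bookkeeping; Illés–Szőnyi–Wettl 1991] -/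
theorem srs_variance_identity (S : Finset (P × L)) (hS : ∀ f ∈ S, ∀ g ∈ S, (f.1 ∈ g.2 ↔ f = g)) :
    ((univ \ S.image Prod.snd).card : ℤ) *
        (∑ ℓ ∈ univ \ S.image Prod.snd, (((S.filter fun f => f.1 ∈ ℓ).card : ℕ) : ℤ) ^ 2) -
      (∑ ℓ ∈ univ \ S.image Prod.snd, (((S.filter fun f => f.1 ∈ ℓ).card : ℕ) : ℤ)) ^ 2 =
      (S.card : ℤ) * ((ProjectivePlane.order P L : ℤ) ^ 3 - ((S.card : ℤ) - 1) ^ 2) := by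
  obtain ⟨-, hsum, hsq, hcard⟩ := srs_moments S hS
  set n : ℕ := ProjectivePlane.order P L with hn_def
  set N : ℕ := S.card with hN_def
  have hsum' : (∑ ℓ ∈ univ \ S.image Prod.snd, (((S.filter fun f => f.1 ∈ ℓ).card : ℕ) : ℤ)) =
      (N : ℤ) * n := by
    rw [← Nat.cast_sum, hsum]
    push_cast
    ring
  have hNN : ((N * (N - 1) : ℕ) : ℤ) = (N : ℤ) * ((N : ℤ) - 1) := by
    rcases Nat.eq_zero_or_pos N with h0 | hpos
    · rw [h0]
      simp
    · push_cast [Nat.cast_sub hpos]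
      ring
  have hsq' : (∑ ℓ ∈ univ \ S.image Prod.snd, (((S.filter fun f => f.1 ∈ ℓ).card : ℕ) : ℤ) ^ 2) =
      (N : ℤ) * ((N : ℤ) - 1) + (N : ℤ) * n := by
    have h := congrArg (Nat.cast : ℕ → ℤ) hsq
    push_cast at h
    rw [h, ← hNN]
    push_cast
    ring
  have hcard' : ((univ \ S.image Prod.snd).card : ℤ) = (n : ℤ) ^ 2 + n + 1 - N := by
    have h := congrArg (Nat.cast : ℕ → ℤ) hcard
    push_cast at h
    linear_combination h
  rw [hsum', hsq', hcard']
  ring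

/-! ## Equality in the Illés–Szőnyi–Wettl bound: the unital -/

open scoped Classical in
/-- **Extremal strong representative systems are unitals (Thas 1974; Illés–Szőnyi–Wettl 1991).**
If a strong representative system `S` of a projective plane of order `n` attains `(|S| − 1)² = n³`,
then `n = r²` is a perfect square, `|S| = r³ + 1`, and every line OTHER than the `|S|` designated
tangents meets the point set of `S` in exactly `r + 1` points (the designated ones meet it once,
`srs_moments`).  So the point set is a unital and the designated lines are its tangents.
Proof: the variance `srs_variance_identity` vanishes, so all `M = n² + n + 1 − |S|` secant degrees equal
one value `c`; then `Mc = |S|n` and `Mc² = |S|(|S| − 1) + |S|n` give `cn = |S| − 1 + n`, i.e.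
`|S| − 1 = n(c − 1)`, and `(|S| − 1)² = n³` gives `(c − 1)² = n`. [Thas 1974; Illés–Szőnyi–Wettl 1991;
Kiss 2008 Thm 1.3] -/
theorem srs_extremal_structure (S : Finset (P × L))
    (hS : ∀ f ∈ S, ∀ g ∈ S, (f.1 ∈ g.2 ↔ f = g))
    (heq : (S.card - 1) ^ 2 = ProjectivePlane.order P L ^ 3) :
    ∃ r : ℕ, ProjectivePlane.order P L = r ^ 2 ∧ S.card = r ^ 3 + 1 ∧
      ∀ ℓ : L, ℓ ∉ S.image Prod.snd → (S.filter fun f => f.1 ∈ ℓ).card = r + 1 := by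
  obtain ⟨-, hsum, hsq, hcard⟩ := srs_moments S hS
  have hvar := srs_variance_identity S hS
  set n : ℕ := ProjectivePlane.order P L with hn_def
  set N : ℕ := S.card with hN_def
  set L' : Finset L := univ \ S.image Prod.snd with hL'_def
  set k : L → ℕ := fun ℓ => (S.filter fun f => f.1 ∈ ℓ).card with hk_def
  have hn1 : 1 < n := ProjectivePlane.one_lt_order P L
  -- `N ≥ 1`
  have hNpos : 0 < N := by
    rcases Nat.eq_zero_or_pos N with h0 | hpos
    · exfalso
      rw [h0] at heq
      have : (0 : ℕ) < n ^ 3 := by positivity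
      simp at heq
      omega
    · exact hpos
  -- the variance vanishes
  have hcast : (((N - 1 : ℕ) : ℤ)) = (N : ℤ) - 1 := by push_cast [Nat.cast_sub hNpos]; ring
  have hslack : (n : ℤ) ^ 3 - ((N : ℤ) - 1) ^ 2 = 0 := by
    have h := congrArg (Nat.cast : ℕ → ℤ) heq
    push_cast at h
    rw [hcast] at h
    linear_combination -h
  rw [hslack, mul_zero] at hvar
  -- hence `M k_ℓ = Σ k` for every secant, where `M = |L'|`
  set M : ℕ := L'.card with hM_def
  set T : ℤ := ∑ ℓ ∈ L', ((k ℓ : ℕ) : ℤ) with hT_def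
  have hsumsq : ∑ ℓ ∈ L', ((M : ℤ) * (k ℓ : ℕ) - T) ^ 2 = 0 := by
    have hexp : ∀ ℓ ∈ L', ((M : ℤ) * (k ℓ : ℕ) - T) ^ 2 =
        (M : ℤ) ^ 2 * ((k ℓ : ℕ) : ℤ) ^ 2 - 2 * (M : ℤ) * T * (k ℓ : ℕ) + T ^ 2 := by
      intro ℓ _
      ring
    rw [Finset.sum_congr rfl hexp, Finset.sum_add_distrib, Finset.sum_sub_distrib, ← Finset.mul_sum,
      ← Finset.mul_sum, Finset.sum_const, ← hT_def, ← hM_def]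
    simp only [nsmul_eq_mul]
    have : (M : ℤ) * ∑ ℓ ∈ L', ((k ℓ : ℕ) : ℤ) ^ 2 - T ^ 2 = 0 := hvar
    linear_combination (M : ℤ) * this
  have hall : ∀ ℓ ∈ L', (M : ℤ) * (k ℓ : ℕ) = T := by
    intro ℓ hℓ
    have h := (Finset.sum_eq_zero_iff_of_nonneg (fun ℓ' _ => sq_nonneg _)).mp hsumsq ℓ hℓ
    have h' : (M : ℤ) * (k ℓ : ℕ) - T = 0 := pow_eq_zero_iff (n := 2) (by norm_num) |>.mp h
    linarith
  -- `L'` is non-empty: `N ≤ n² + n`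
  have hNle : N ≤ n ^ 2 + n := by
    by_contra hlt
    push Not at hlt
    have h1 : n ^ 2 + n ≤ N - 1 := by omega
    have h2 : (n ^ 2 + n) ^ 2 ≤ (N - 1) ^ 2 := Nat.pow_le_pow_left h1 2
    rw [heq] at h2
    nlinarith
  have hMpos : 0 < M := by
    have : M + N = n ^ 2 + n + 1 := hcard
    omega
  obtain ⟨ℓ₀, hℓ₀⟩ : L'.Nonempty := Finset.card_pos.mp hMpos
  set c : ℕ := k ℓ₀ with hc_def
  have hconst : ∀ ℓ ∈ L', k ℓ = c := by
    intro ℓ hℓ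
    have h1 := hall ℓ hℓ
    have h2 := hall ℓ₀ hℓ₀
    have h3 : (M : ℤ) * (k ℓ : ℕ) = (M : ℤ) * (k ℓ₀ : ℕ) := by rw [h1, h2]
    have h4 : ((k ℓ : ℕ) : ℤ) = ((k ℓ₀ : ℕ) : ℤ) :=
      mul_left_cancel₀ (by exact_mod_cast hMpos.ne') h3
    exact_mod_cast h4
  -- `M c = N n` and `M c² = N (N - 1) + N n`
  have hMc : M * c = N * n := by
    rw [← hsum, Finset.sum_congr rfl hconst, Finset.sum_const, smul_eq_mul]
  have hMc2 : M * c ^ 2 = N * (N - 1) + N * n := by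
    rw [← hsq, Finset.sum_congr rfl fun ℓ hℓ => by
      rw [show (S.filter fun f => f.1 ∈ ℓ).card = c from hconst ℓ hℓ], Finset.sum_const, smul_eq_mul]
  -- hence `c n = N - 1 + n`
  have hcn : c * n = N - 1 + n := by
    have h : N * (c * n) = N * (N - 1 + n) := by
      calc N * (c * n) = c * (N * n) := by ring
        _ = c * (M * c) := by rw [hMc]
        _ = M * c ^ 2 := by ring
        _ = N * (N - 1) + N * n := hMc2
        _ = N * (N - 1 + n) := by ring
    exact Nat.eq_of_mul_eq_mul_left hNpos h
  have hcpos : 1 ≤ c := by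
    rcases Nat.eq_zero_or_pos c with h0 | hpos
    · rw [h0, zero_mul] at hcn
      omega
    · exact hpos
  -- `c = r + 1`: `r n = N - 1`, `r² = n`, `N = r³ + 1`
  obtain ⟨r, hcr⟩ : ∃ r, c = r + 1 := ⟨c - 1, (Nat.sub_add_cancel hcpos).symm⟩
  have hrn : r * n = N - 1 := by
    have h : r * n + n = (N - 1) + n := by
      calc r * n + n = (r + 1) * n := by ring
        _ = N - 1 + n := by rw [← hcr]; exact hcn
    exact Nat.add_right_cancel h
  have hrsq : r ^ 2 = n := by
    have hn0 : 0 < n ^ 2 := by positivity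
    have h : r ^ 2 * n ^ 2 = n * n ^ 2 := by
      calc r ^ 2 * n ^ 2 = (r * n) ^ 2 := by ring
        _ = n ^ 3 := by rw [hrn, heq]
        _ = n * n ^ 2 := by ring
    exact Nat.eq_of_mul_eq_mul_right hn0 h
  refine ⟨r, hrsq.symm, ?_, fun ℓ hℓ => ?_⟩
  · have h : N - 1 = r ^ 3 := by
      calc N - 1 = r * n := hrn.symm
        _ = r * r ^ 2 := by rw [hrsq]
        _ = r ^ 3 := by ring
    omega
  · have hℓ' : ℓ ∈ L' := by
      rw [hL'_def, Finset.mem_sdiff]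
      exact ⟨Finset.mem_univ _, hℓ⟩
    rw [show (S.filter fun f => f.1 ∈ ℓ).card = c from hconst ℓ hℓ', hcr]

open scoped Classical in
/-- **An extremal system blocks every line.**  Under `(|S| − 1)² = n³` every line of the plane
contains a point of `S` (a unital is a blocking set: tangents meet it once, all other lines `r + 1 ≥ 1`
times). [Thas 1974; Illés–Szőnyi–Wettl 1991 (corollary)] -/
theorem srs_extremal_blocking (S : Finset (P × L))
    (hS : ∀ f ∈ S, ∀ g ∈ S, (f.1 ∈ g.2 ↔ f = g))
    (heq : (S.card - 1) ^ 2 = ProjectivePlane.order P L ^ 3) (ℓ : L) :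
    ∃ f ∈ S, f.1 ∈ ℓ := by
  obtain ⟨r, -, -, hsec⟩ := srs_extremal_structure S hS heq
  obtain ⟨htan, -, -, -⟩ := srs_moments S hS
  have hpos : 0 < (S.filter fun f => f.1 ∈ ℓ).card := by
    by_cases hℓ : ℓ ∈ S.image Prod.snd
    · rw [htan ℓ hℓ]
      exact Nat.one_pos
    · rw [hsec ℓ hℓ]
      exact Nat.succ_pos r
  obtain ⟨f, hf⟩ := Finset.card_pos.mp hpos
  exact ⟨f, (Finset.mem_filter.mp hf).1, (Finset.mem_filter.mp hf).2⟩

open scoped Classical in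
/-- **In an extremal system the tangent at each point is unique.**  Under `(|S| − 1)² = n³`, if a
line `ℓ` through the point `f.1` of a flag `f ∈ S` meets the point set of `S` only in `f.1`, then
`ℓ = f.2`: a unital has exactly one tangent per point, so an extremal system is determined by its
point set. [Thas 1974; Illés–Szőnyi–Wettl 1991 (corollary)] -/
theorem srs_extremal_tangent_unique (S : Finset (P × L))
    (hS : ∀ f ∈ S, ∀ g ∈ S, (f.1 ∈ g.2 ↔ f = g))
    (heq : (S.card - 1) ^ 2 = ProjectivePlane.order P L ^ 3)
    (f : P × L) (hf : f ∈ S) (ℓ : L) (hfℓ : f.1 ∈ ℓ)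
    (hone : (S.filter fun g => g.1 ∈ ℓ).card = 1) : ℓ = f.2 := by
  obtain ⟨r, hr, -, hsec⟩ := srs_extremal_structure S hS heq
  have hn1 : 1 < ProjectivePlane.order P L := ProjectivePlane.one_lt_order P L
  have hrpos : 0 < r := by
    rcases Nat.eq_zero_or_pos r with h0 | hpos
    · rw [h0] at hr
      omega
    · exact hpos
  by_cases hℓ : ℓ ∈ S.image Prod.snd
  · obtain ⟨g, hg, rfl⟩ := Finset.mem_image.mp hℓ
    have hfg : f = g := (hS f hf g hg).mp hfℓ
    rw [hfg]
  · rw [hsec ℓ hℓ] at hone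
    omega

/-! ## Non-square and prime orders: the bound is strict -/

/-- **Strict ISW in non-square order.**  If the order `n` of the plane is not a perfect square, every
strong representative system has `(|S| − 1)² < n³`: equality would make `n` a square
(`srs_extremal_structure`).  This is the projective-plane form of the statement "tangency sets of
size `n√n + 1` exist only in square order" underlying the Hermitian-unital axis. [Thas 1974;
Illés–Szőnyi–Wettl 1991 (corollary)] -/
theorem srs_card_sub_one_sq_lt_of_not_isSquare (hn : ¬ IsSquare (ProjectivePlane.order P L))
    (S : Finset (P × L)) (hS : ∀ f ∈ S, ∀ g ∈ S, (f.1 ∈ g.2 ↔ f = g)) :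
    (S.card - 1) ^ 2 < ProjectivePlane.order P L ^ 3 := by
  refine lt_of_le_of_ne (srs_card_sub_one_sq_le S hS) fun heq => hn ?_
  obtain ⟨r, hr, -, -⟩ := srs_extremal_structure S hS heq
  exact ⟨r, by rw [hr, sq]⟩

/-- **Strict ISW in prime order.**  In a projective plane of prime order `p` (such as `PG(2,p)`, the
projective closure of the plane of `stub_tangencySets`) every strong representative system has
`(|S| − 1)² < p³`: the unital size `p√p + 1` is never attained. [Thas 1974; Illés–Szőnyi–Wettl 1991
(corollary)] -/
theorem srs_card_sub_one_sq_lt_of_prime (hp : (ProjectivePlane.order P L).Prime)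
    (S : Finset (P × L)) (hS : ∀ f ∈ S, ∀ g ∈ S, (f.1 ∈ g.2 ↔ f = g)) :
    (S.card - 1) ^ 2 < ProjectivePlane.order P L ^ 3 := by
  refine srs_card_sub_one_sq_lt_of_not_isSquare ?_ S hS
  rintro ⟨m, hm⟩
  rw [hm, Nat.prime_mul_iff] at hp
  rcases hp with ⟨h, rfl⟩ | ⟨h, rfl⟩ <;> exact Nat.not_prime_one h

end Summit.MatrixMultiplication.MatrixMultiplication.Theorems.LevelOneGL2Designs.PlaneUnital
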